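import Summits.BirchSwinnertonDyer.BirchSwinnertonDyer.Theorems.ResidualThetaTransportAtTwoThetaLayerLambdaCongruenceAtTwoParabolicCharacterFactor
import Summits.BirchSwinnertonDyer.BirchSwinnertonDyer.Theorems.ManinLocalTwoThreeTwoShiftTower
import Summits.BirchSwinnertonDyer.Rank2.LevelFifteenEisensteinPeriod
import Literature.NumberTheory.EllipticCurves.ModularFormsGamma0Genus
import Literature.NumberTheory.EllipticCurves.ModularCurveNewformDimension
import Literature.NumberTheory.EllipticCurves.ModularCurveEtaProductsProofs
import Literature.NumberTheory.EllipticCurves.ModularCurveEtaQuotientsProofs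
import Literature.NumberTheory.EllipticCurves.ManinConstantGamma1ModularDegree
import HarnessLib

/-!
# C2 `ManinOddAtFour` helper (es g45, T-es-102, part 1 of 2: §1–§2 general theory; §3–§5 = `…ShimuraClassesGenusOne`) — SHIMURA COVERING CLASSES `φ_χ : H₁(X₀(N), ℤ) → R` AT ARBITRARY LEVEL,
# FACT-FREE; the `2`-PRIMARY classes at the ADDITIVE genus-one levels `20`, `24`, `32` and at `17`: the Shimura index
# `[Λ(f) : Λ₁(f)]` is EVEN for every `f ≠ 0` in `S₂(Γ₀(N))`, `N ∈ {20, 24, 32}`, and the class of `{∞, γ₃∞}_f` is not killed by `2`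
# in `Λ(f)/Λ₁(f)` on `S₂(Γ₀(17))`

HONEST FRAMING. Printed mathematics (Mazur 1977 §II.11; Ling–Oesterlé 1991 Thm 1: the Shimura subgroup `Σ(N) = ker(J₀(N) → J₁(N))`
and its order; Stevens 1989 §2), new formal proofs. Beyond-print theorem: NO. Nothing about the Manin constant of any curve is
asserted; C2, C3, Manin's conjecture and BSD stay OPEN. No `sorry`, no new axiom, no instance/notation.

WHAT. §1 (`exists_shimuraHom`): `N ≥ 1`, `m ∣ N` with the CUSP CONDITION `N ∣ w·r² ⇒ m ∣ w·r` (automatic for squarefree `m`;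
for `m = ℓ^κ` it says `ℓ^{2κ−1} ∣ N`), `R` an additive group without `3`-torsion, `χ : ℤ/m → R` additive on units and even, and the
ELLIPTIC CONDITION `N ∣ d² + 1 ⇒ χ(d) = 0` (vacuous when `4 ∣ N`). Then the SHIMURA CHARACTER `u_χ(γ) := χ(d_γ mod m)` of `Γ₀(N)` is
additive, kills every cusp stabiliser (`γ = kβk⁻¹`, `β = ±(1 w; 0 1)`, forces `γ₁₀ = −w r²`, `d_γ = ±1 + w p r` with `(p, r)` the first
column of `k` — `apply_one_one_eq_of_conj_upper` — so `N ∣ w r²`, `m ∣ w r`, `d_γ ≡ ±1 (mod m)`) and every order-`4` elliptic element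
(`γ² = −1 ⇒ N ∣ d_γ² + 1`); by the LANDED factorisation `ThetaLayerLambdaCongruenceAtTwo.exists_addMonoidHom_periodHomology_of_cuspCharacter`
(route ResidualThetaTransportAtTwo, p3-w2; genus formula a tree theorem) it FACTORS THROUGH THE PERIOD LATTICE:
`∃ φ : periodHomology N →+ R, φ({∞, k∞}) = χ(d_k mod m)` for all `k ∈ Γ₀(N)`. `exists_shimuraHom_of_four_dvd`: at levels `4 ∣ N` only
the cusp condition remains — for every prime `q` with `4q ∣ N` and every even additive-on-units `χ : ℤ/q → R` (e.g. the Legendre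
symbol for `q ≡ 1 (mod 4)`, read in `ℤ/2`) there is a `2`-primary Shimura class at the ADDITIVE level `N`.
§2 (`zsmul_cuspSymbol_not_mem_of_hom`): on a line `S₂(Γ₀(N)) = ℂ·f` a class descends to `Λ(f)`: `n·{∞, γ∞}_f ∉ Λ₁(f)` whenever
`n·χ(d_γ) ≠ 0` (evaluation at `f` is injective on the dual of a line; `Λ₁(f)` is generated by `Γ₁(N)`-periods, `d ≡ 1`).
§3 LEVEL `17` (`n(17) = 4`; `χ₁₇ = log₃ mod 4 : ℤ/17 → ℤ/4`, a decide-table; `γ₃ = (6 1; 17 3)`; `dim S₂(Γ₀(17)) = g = 1` by the tree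
theorems `finrank_cuspForm_two_eq_genusX0_holds`, `genusX0_prime`): **`n·{∞, γ₃∞}_f ∉ Λ₁(f)` for `4 ∤ n`**, so `Λ(f) ≠ Λ₁(f)` and
`2Λ(f) ⊄ Λ₁(f)` for every `f ≠ 0` (E15-LATTICE-INDEX-v1 row `17a1`: index `4`, snf `[4,1]`).
§4 THE ADDITIVE LEVEL `20 = 4·5` (`χ₅` = Legendre symbol mod `5` read in `ℤ/2`; `γ₇ = (3 1; 20 7)`, `(7|5) = (2|5) = −1`;
`dim S₂(Γ₀(20)) = 1` = `finrank_cuspForm_two_eq_genusX0_twenty`): **`{∞, γ₇∞}_f ∉ Λ₁(f)` and `Λ(f) ≠ Λ₁(f)` for every non-zero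
`f ∈ S₂(Γ₀(20))`** — the Shimura index at the additive level `20` is EVEN, fact-free (E15 row `20a1`: index `2`, snf `[2,1]`). For
C2 this is a NEGATIVE datum: «`[Λ₀ : Λ₁]` odd at `4 ∣ N`» is false already at `N = 20`, so the `2`-part of `c₀` cannot be read off `c₁`
by index parity alone at such levels (the route's Stevens-parity reduction rightly restricts to Kummer-blind classes).
§5 THE ADDITIVE GENUS-ONE LEVELS `24 = 8·3` AND `32 = 2⁵` (prime-power moduli: `χ₁₂ = (12 | ·)` needs `2³ ∣ N`, `χ₈ = (2 | ·)` needs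
`2⁵ ∣ N`; the cusp condition is a finite residue check `cuspCondition_of_residues`, by `decide` mod `24` / `32`; `dim S₂ = 1` by
`genusX0_twentyFour` / `finrank_cuspForm_two_eq_genusX0_thirtyTwo`): **`Λ(f) ≠ Λ₁(f)` for every non-zero `f` in `S₂(Γ₀(24))` and in
`S₂(Γ₀(32))`** (E15 rows `24a1`, `32a1`: index `2`). In the language of `…ManinLocalTwoThreeShimuraTwoCharOfPeriods` (the period class
is a Kronecker symbol `(q | d_γ)` for an admissible squarefree `q ∣ N`, triviality undecided there): `q ≠ 1` at `N = 20, 24, 32` — the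
class IS `(5 | ·)`, `(12 | ·) = (3 | ·)χ₋₄`, `(2 | ·)` respectively, non-trivial. The remaining genus-one level with `4 ∣ N`, `36`, admits
no even cusp-unramified quadratic character (E15 row `36a1`: index `1`); `27` (`9 ∣ N`, C3) carries a CUBIC class (E15 `27a1`: index `3`)
outside the reach of the landed factorisation, whose coefficient group must have no `3`-torsion.

References: [Mazur1977] §II.11; [LingOesterle1991] Thm. 1; [Stevens1989] §2; [Manin1972] §1.5–1.7, Thm. 1.9; [CremonaAlgorithms1997] §2.1–2.2.
-/

set_option autoImplicit false

noncomputable section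

-- justification: the `Summit.BirchSwinnertonDyer.BirchSwinnertonDyer.…` path repeats a component (route-file convention)
set_option linter.dupNamespace false

open scoped Classical MatrixGroups

open CongruenceSubgroup Matrix.SpecialLinearGroup ModularGroup
open Literature.NumberTheory.EllipticCurves.ModularForms
open Summit.BirchSwinnertonDyer.BirchSwinnertonDyer.Theorems.ThetaLayerLambdaCongruenceAtTwo

namespace Summit.BirchSwinnertonDyer.BirchSwinnertonDyer.Theorems.ManinLocalTwoThree.ShimuraClass

/-! ## §1. Shimura characters of `Γ₀(N)` factor through the period lattice -/

section General

variable {N : ℕ} {m : ℕ} {R : Type} [AddCommGroup R] (χ : ZMod m → R)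

/-- `det = 1` written out. [folklore] -/
theorem sl_det (g : SL(2, ℤ)) : (g 0 0 : ℤ) * g 1 1 - g 0 1 * g 1 0 = 1 := by
  have := Matrix.SpecialLinearGroup.det_coe g
  rwa [Matrix.det_fin_two] at this

/-- **Conjugates of `±`unipotents.** If `kβ = γk` with `β` upper triangular, `β₀₀ = β₁₁ = ε`, `β₀₁ = w`, and `(p, r)` is the
first column of `k`, then `γ₁₁ = ε + w·p·r` and `γ₁₀ = −w·r²`. [folklore] -/
theorem apply_one_one_eq_of_conj_upper (γ k β : SL(2, ℤ)) (hβ : k * β = γ * k) (h10 : β 1 0 = 0) (hε : β 0 0 = β 1 1) :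
    (γ 1 1 : ℤ) = β 1 1 + β 0 1 * k 0 0 * k 1 0 ∧ (γ 1 0 : ℤ) = -(β 0 1 * k 1 0 ^ 2) := by
  have E1 := congrArg (fun g : SL(2, ℤ) ↦ (g 1 0 : ℤ)) hβ
  have E2 := congrArg (fun g : SL(2, ℤ) ↦ (g 1 1 : ℤ)) hβ
  simp only [_root_.Summit.BirchSwinnertonDyer.Rank2.LevelFifteen.sl_mul_apply', h10, hε, mul_zero, add_zero] at E1 E2
  have hdet := sl_det k
  constructor
  · linear_combination (k 0 1 : ℤ) * E1 - (k 0 0 : ℤ) * E2 + ((β 1 1 : ℤ) - γ 1 1) * hdet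
  · linear_combination -(k 1 1 : ℤ) * E1 + (k 1 0 : ℤ) * E2 - (γ 1 0 : ℤ) * hdet

/-- `γk = kS ⇒ γ² = −1`. [folklore] -/
theorem mul_self_eq_neg_one_of_conj_S (γ k : SL(2, ℤ)) (h : γ * k = k * S) : γ * γ = -1 := by
  have hγ : γ = k * S * k⁻¹ := by rw [← h, mul_inv_cancel_right]
  calc γ * γ = k * S * k⁻¹ * (k * S * k⁻¹) := by rw [hγ]
    _ = k * (S * S) * k⁻¹ := by group
    _ = -1 := by rw [S_mul_S_eq_neg_one, mul_neg_one, neg_mul, mul_inv_cancel]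

/-- **The Shimura character of `χ`** on `Γ₀(N)`: `u_χ(γ) = χ(d_γ mod m)`. [cite: Mazur1977, §II.11] -/
def shimuraCharacter (γ : Gamma0 N) : R := χ ((((γ : SL(2, ℤ)) 1 1 : ℤ) : ZMod m))

variable {χ}

/-- `χ(1) = 0` and `χ(−1) = 0` for an even additive-on-units `χ`. [folklore] -/
theorem char_one_and_neg_one (hmul : ∀ x x' y y' : ZMod m, x * x' = 1 → y * y' = 1 → χ (x * y) = χ x + χ y)
    (hneg : ∀ x, χ (-x) = χ x) : χ 1 = 0 ∧ χ (-1) = 0 := by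
  have h1 : χ 1 = 0 := by
    have h := hmul 1 1 1 1 (mul_one 1) (mul_one 1)
    rw [mul_one] at h
    exact left_eq_add.mp h
  exact ⟨h1, by rw [hneg, h1]⟩

/-- **Additivity** of the Shimura character (`m ∣ N`). [folklore] -/
theorem shimuraCharacter_mul (hm : m ∣ N)
    (hmul : ∀ x x' y y' : ZMod m, x * x' = 1 → y * y' = 1 → χ (x * y) = χ x + χ y) (γ δ : Gamma0 N) :
    shimuraCharacter χ (γ * δ) = shimuraCharacter χ γ + shimuraCharacter χ δ := by
  have c0 : ∀ η : Gamma0 N, ((((η : SL(2, ℤ)) 1 0 : ℤ) : ZMod m)) = 0 := fun η ↦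
    (ZMod.intCast_zmod_eq_zero_iff_dvd _ m).mpr ((Int.natCast_dvd_natCast.mpr hm).trans (_root_.Summit.BirchSwinnertonDyer.BirchSwinnertonDyer.Theorems.ManinLocalTwoThree.TwoShift.level_dvd_c η))
  have inv : ∀ η : Gamma0 N, ((((η : SL(2, ℤ)) 1 1 : ℤ) : ZMod m)) * ((((η : SL(2, ℤ)) 0 0 : ℤ) : ZMod m)) = 1 := fun η ↦ by
    have := congrArg (Int.cast : ℤ → ZMod m) (sl_det (η : SL(2, ℤ)))
    push_cast at this
    rw [c0 η, mul_zero, sub_zero] at this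
    rwa [mul_comm] at this
  have e : (((((γ * δ : Gamma0 N) : SL(2, ℤ)) 1 1 : ℤ) : ZMod m)) =
      ((((γ : SL(2, ℤ)) 1 1 : ℤ) : ZMod m)) * ((((δ : SL(2, ℤ)) 1 1 : ℤ) : ZMod m)) := by
    rw [show ((γ * δ : Gamma0 N) : SL(2, ℤ)) = (γ : SL(2, ℤ)) * δ from rfl, _root_.Summit.BirchSwinnertonDyer.Rank2.LevelFifteen.sl_mul_apply']
    push_cast
    rw [c0 γ, zero_mul, zero_add]
  rw [shimuraCharacter, e, hmul _ _ _ _ (inv γ) (inv δ)]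
  rfl

/-- **The Shimura character kills every cusp stabiliser** under the cusp condition `N ∣ w r² ⇒ m ∣ w r`. [cite: LingOesterle1991, Thm. 1] -/
theorem shimuraCharacter_eq_zero_of_conj_upper (hmN : ∀ w r : ℤ, (N : ℤ) ∣ w * r ^ 2 → (m : ℤ) ∣ w * r)
    (hmul : ∀ x x' y y' : ZMod m, x * x' = 1 → y * y' = 1 → χ (x * y) = χ x + χ y) (hneg : ∀ x, χ (-x) = χ x)
    (γ : Gamma0 N) (k : SL(2, ℤ)) (h : (k⁻¹ * (γ : SL(2, ℤ)) * k) 1 0 = 0) : shimuraCharacter χ γ = 0 := by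
  set β : SL(2, ℤ) := k⁻¹ * (γ : SL(2, ℤ)) * k with hβdef
  have hβ : k * β = (γ : SL(2, ℤ)) * k := by
    rw [hβdef, ← mul_assoc, ← mul_assoc, mul_inv_cancel, one_mul]
  have hdet := sl_det β
  rw [h, mul_zero, sub_zero] at hdet
  obtain ⟨h1, h2⟩ := char_one_and_neg_one hmul hneg
  rcases Int.eq_one_or_neg_one_of_mul_eq_one' hdet with ⟨ha, hd⟩ | ⟨ha, hd⟩
  all_goals
    obtain ⟨e11, e10⟩ := apply_one_one_eq_of_conj_upper _ k β hβ h (by rw [ha, hd])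
    have hN : (N : ℤ) ∣ (β 0 1 : ℤ) * (k 1 0 : ℤ) ^ 2 := by
      have := _root_.Summit.BirchSwinnertonDyer.BirchSwinnertonDyer.Theorems.ManinLocalTwoThree.TwoShift.level_dvd_c γ
      rw [e10] at this
      exact (dvd_neg.mp this)
    have hm0 : ((((β 0 1 : ℤ) * (k 0 0 : ℤ) * (k 1 0 : ℤ) : ℤ) : ZMod m)) = 0 := by
      rw [ZMod.intCast_zmod_eq_zero_iff_dvd, mul_assoc, mul_comm (k 0 0 : ℤ), ← mul_assoc]
      exact dvd_mul_of_dvd_left (hmN _ _ hN) _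
    rw [shimuraCharacter, e11, hd]
    push_cast at hm0 ⊢
    rw [hm0, add_zero]
    assumption

/-- **The Shimura character kills the order-`4` elliptic elements** under `N ∣ d² + 1 ⇒ χ(d) = 0`. [folklore] -/
theorem shimuraCharacter_eq_zero_of_conj_S (h4 : ∀ d : ℤ, (N : ℤ) ∣ d * d + 1 → χ ((d : ZMod m)) = 0)
    (γ : Gamma0 N) (k : SL(2, ℤ)) (h : (γ : SL(2, ℤ)) * k = k * S) : shimuraCharacter χ γ = 0 := by
  have hsq := mul_self_eq_neg_one_of_conj_S _ k h
  have h11 := congrArg (fun g : SL(2, ℤ) ↦ (g 1 1 : ℤ)) hsq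
  simp only [_root_.Summit.BirchSwinnertonDyer.Rank2.LevelFifteen.sl_mul_apply'] at h11
  have em : ((-1 : SL(2, ℤ)) 1 1 : ℤ) = -1 := by simp
  rw [em] at h11
  apply h4
  have hc := _root_.Summit.BirchSwinnertonDyer.BirchSwinnertonDyer.Theorems.ManinLocalTwoThree.TwoShift.level_dvd_c γ
  have e : ((γ : SL(2, ℤ)) 1 1 : ℤ) * (γ : SL(2, ℤ)) 1 1 + 1 = -(((γ : SL(2, ℤ)) 1 0 : ℤ) * (γ : SL(2, ℤ)) 0 1) := by
    linear_combination h11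
  rw [e, dvd_neg]
  exact dvd_mul_of_dvd_left hc _

/-- **SHIMURA COVERING CLASSES (fact-free).** `m ∣ N` with the cusp condition, `R` without `3`-torsion, `χ : ℤ/m → R` additive on
units and even with the elliptic condition: there is `φ : periodHomology N →+ R` on `H₁(X₀(N), ℤ) ⊂ S₂(Γ₀(N))^∨` with
`φ({∞, k∞}) = χ(d_k mod m)` for every `k ∈ Γ₀(N)`. [cite: Mazur1977, §II.11] -/
theorem exists_shimuraHom [NeZero N] (hm : m ∣ N) (hmN : ∀ w r : ℤ, (N : ℤ) ∣ w * r ^ 2 → (m : ℤ) ∣ w * r)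
    (hmul : ∀ x x' y y' : ZMod m, x * x' = 1 → y * y' = 1 → χ (x * y) = χ x + χ y) (hneg : ∀ x, χ (-x) = χ x)
    (h4 : ∀ d : ℤ, (N : ℤ) ∣ d * d + 1 → χ ((d : ZMod m)) = 0) (h3 : ∀ r : R, r + r + r = 0 → r = 0) :
    ∃ φ : periodHomology N →+ R, ∀ k : Gamma0 N,
      φ ⟨periodFunctional N k, periodFunctional_mem_periodHomology N k⟩ = χ ((((k : SL(2, ℤ)) 1 1 : ℤ) : ZMod m)) :=
  exists_addMonoidHom_periodHomology_of_cuspCharacter (shimuraCharacter χ) (shimuraCharacter_mul hm hmul)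
    (shimuraCharacter_eq_zero_of_conj_upper hmN hmul hneg) (shimuraCharacter_eq_zero_of_conj_S h4) h3

/-- `4 ∤ d² + 1`. [folklore] -/
theorem not_four_dvd_sq_add_one (d : ℤ) : ¬ (4 : ℤ) ∣ d * d + 1 := by
  intro h
  have h' : (((d * d + 1 : ℤ)) : ZMod 4) = 0 := (ZMod.intCast_zmod_eq_zero_iff_dvd _ 4).mpr h
  push_cast at h'
  revert h'
  generalize (d : ZMod 4) = x
  revert x
  decide

/-- A prime `q ∣ N` satisfies the cusp condition. [folklore] -/
theorem cuspCondition_of_prime {q : ℕ} (hq : q.Prime) (hqN : q ∣ N) (w r : ℤ) (h : (N : ℤ) ∣ w * r ^ 2) :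
    (q : ℤ) ∣ w * r := by
  have hp : Prime (q : ℤ) := Nat.prime_iff_prime_int.mp hq
  have h' : (q : ℤ) ∣ w * r ^ 2 := ((Int.natCast_dvd_natCast.mpr hqN).trans h)
  rcases hp.dvd_mul.mp h' with hw | hr
  · exact dvd_mul_of_dvd_left hw _
  · exact dvd_mul_of_dvd_right (hp.dvd_of_dvd_pow hr) _

/-- **The cusp condition from a finite residue check**: if `a·b² = 0 ⇒ m ∣ (a·b) mod N` on `ℤ/N`, then `N ∣ w r² ⇒ m ∣ w r`
(used for prime-power `m`, e.g. `(N, m) = (24, 12), (32, 8)`). [folklore] -/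
theorem cuspCondition_of_residues [NeZero N] (hm : m ∣ N) (h : ∀ a b : ZMod N, a * b ^ 2 = 0 → (a * b).val % m = 0)
    (w r : ℤ) (hN : (N : ℤ) ∣ w * r ^ 2) : (m : ℤ) ∣ w * r := by
  have h0 : (((w * r ^ 2 : ℤ)) : ZMod N) = 0 := (ZMod.intCast_zmod_eq_zero_iff_dvd _ N).mpr hN
  push_cast at h0
  have h1 := h _ _ h0
  have h2 : (m : ℤ) ∣ ((((w * r : ℤ) : ZMod N)).val : ℤ) := by
    push_cast
    exact Int.natCast_dvd_natCast.mpr (Nat.dvd_of_mod_eq_zero h1)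
  rw [ZMod.val_intCast] at h2
  have h3 : (m : ℤ) ∣ w * r - w * r % N :=
    (Int.natCast_dvd_natCast.mpr hm).trans (Int.modEq_iff_dvd.mp (Int.mod_modEq (w * r) N))
  have h4 := dvd_add h3 h2
  rwa [sub_add_cancel] at h4

/-- At levels `4 ∣ N` the elliptic condition is vacuous (`4 ∤ d² + 1`). [folklore] -/
theorem elliptic_vacuous_of_four_dvd (h4N : 4 ∣ N) (d : ℤ) (hd : (N : ℤ) ∣ d * d + 1) : χ ((d : ZMod m)) = 0 :=
  (not_four_dvd_sq_add_one d ((Int.natCast_dvd_natCast.mpr h4N).trans (by exact_mod_cast hd))).elim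

/-- **`2`-primary (and other) Shimura classes at ADDITIVE levels `4 ∣ N`**: for a prime `q` with `q ∣ N`, `4 ∣ N`, and ANY even
additive-on-units `χ : ℤ/q → R` (`R` without `3`-torsion) the class `φ_χ` exists — no elliptic condition. [cite: LingOesterle1991, Thm. 1] -/
theorem exists_shimuraHom_of_four_dvd [NeZero N] {q : ℕ} (hq : q.Prime) (hqN : q ∣ N) (h4N : 4 ∣ N) (χ : ZMod q → R)
    (hmul : ∀ x x' y y' : ZMod q, x * x' = 1 → y * y' = 1 → χ (x * y) = χ x + χ y) (hneg : ∀ x, χ (-x) = χ x)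
    (h3 : ∀ r : R, r + r + r = 0 → r = 0) :
    ∃ φ : periodHomology N →+ R, ∀ k : Gamma0 N,
      φ ⟨periodFunctional N k, periodFunctional_mem_periodHomology N k⟩ = χ ((((k : SL(2, ℤ)) 1 1 : ℤ) : ZMod q)) :=
  exists_shimuraHom hqN (cuspCondition_of_prime hq hqN) hmul hneg
    (fun d hd ↦ (not_four_dvd_sq_add_one d ((Int.natCast_dvd_natCast.mpr h4N).trans (by exact_mod_cast hd))).elim) h3

end General

/-! ## §2. Descent to a form spanning `S₂(Γ₀(N))` -/

section Descent

variable {N : ℕ} [NeZero N] {R : Type} [AddCommGroup R]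

/-- **Descent of a covering class to `Λ(f)` on a line `S₂(Γ₀(N)) = ℂ·f`.** If `φ : periodHomology N →+ R` takes the value `v k` on
`{∞, k∞}` with `v = 0` on `Γ₁(N)`, then for `γ ∈ Γ₀(N)` and `n ∈ ℤ` with `n·v(γ) ≠ 0`: `n·{∞, γ∞}_f ∉ Λ₁(f)`. [folklore] -/
theorem zsmul_cuspSymbol_not_mem_of_hom (φ : periodHomology N →+ R) (v : Gamma0 N → R)
    (hφ : ∀ k : Gamma0 N, φ ⟨periodFunctional N k, periodFunctional_mem_periodHomology N k⟩ = v k)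
    (hv : ∀ γ₁ : Gamma1 N, v ⟨(γ₁ : SL(2, ℤ)), Gamma1_in_Gamma0 N γ₁.2⟩ = 0)
    (f : CuspForm (Gamma0 N) 2) (hspan : ∀ w : CuspForm (Gamma0 N) 2, ∃ c : ℂ, c • f = w)
    (γ : Gamma0 N) (n : ℤ) (hγ : n • v γ ≠ 0) : (n : ℂ) * cuspSymbol f γ ∉ periodLatticeGamma1 f := by
  have hinj : ∀ x y : Module.Dual ℂ (CuspForm (Gamma0 N) 2), x f = y f → x = y := fun x y hxy ↦ by
    refine LinearMap.ext fun w ↦ ?_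
    obtain ⟨c, rfl⟩ := hspan w
    rw [map_smul, map_smul, hxy]
  intro hmem
  have key : ∀ z ∈ periodLatticeGamma1 f, ∃ x : periodHomology N,
      (x : Module.Dual ℂ (CuspForm (Gamma0 N) 2)) f = z ∧ φ x = 0 := by
    intro z hz
    refine AddSubgroup.closure_induction (fun z hz ↦ ?_) ?_ (fun x y _ _ hx hy ↦ ?_) (fun x _ hx ↦ ?_) hz
    · obtain ⟨γ₁, rfl⟩ := hz
      exact ⟨⟨periodFunctional N ⟨(γ₁ : SL(2, ℤ)), Gamma1_in_Gamma0 N γ₁.2⟩,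
        periodFunctional_mem_periodHomology N _⟩, rfl, by rw [hφ, hv]⟩
    · exact ⟨0, by simp, map_zero φ⟩
    · obtain ⟨a, ha, ha0⟩ := hx
      obtain ⟨b, hb, hb0⟩ := hy
      exact ⟨a + b, by simp [ha, hb], by rw [map_add, ha0, hb0, add_zero]⟩
    · obtain ⟨a, ha, ha0⟩ := hx
      exact ⟨-a, by simp [ha], by rw [map_neg, ha0, neg_zero]⟩
  obtain ⟨x, hx, hx0⟩ := key _ hmem
  have hmem' : n • periodFunctional N γ ∈ periodHomology N :=
    AddSubgroup.zsmul_mem _ (periodFunctional_mem_periodHomology N γ) n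
  have hxe : x = ⟨n • periodFunctional N γ, hmem'⟩ :=
    Subtype.ext (hinj _ _ (by rw [hx, LinearMap.smul_apply, periodFunctional_apply, zsmul_eq_mul]))
  have hsm : (⟨n • periodFunctional N γ, hmem'⟩ : periodHomology N) =
      n • ⟨periodFunctional N γ, periodFunctional_mem_periodHomology N γ⟩ := rfl
  rw [hxe, hsm, map_zsmul, hφ] at hx0
  exact hγ hx0

omit [NeZero N] in
/-- The `Γ₁(N)`-vanishing of `k ↦ χ(d_k mod m)` (`m ∣ N`, `χ(1) = 0`). [folklore] -/
theorem char_apply_gamma1 {m : ℕ} (hm : m ∣ N) (χ : ZMod m → R) (h1 : χ 1 = 0) (γ₁ : Gamma1 N) :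
    χ ((((γ₁ : SL(2, ℤ)) 1 1 : ℤ) : ZMod m)) = 0 := by
  have h11 : ((((γ₁ : SL(2, ℤ)) 1 1 : ℤ) : ZMod N)) = 1 := ((Gamma1_mem N _).mp γ₁.2).2.1
  have : ((((γ₁ : SL(2, ℤ)) 1 1 : ℤ) : ZMod m)) = 1 := by
    have := congrArg (ZMod.castHom hm (ZMod m)) h11
    rwa [map_intCast, map_one] at this
  exact this ▸ h1

end Descent

end Summit.BirchSwinnertonDyer.BirchSwinnertonDyer.Theorems.ManinLocalTwoThree.ShimuraClass
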